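/-
Copyright (c) 2026. All rights reserved.
Released under Apache 2.0 license as described in the file LICENSE.
-/
import Literature.Geometry.Kaehler.ComplexTorusQuaternionXSixEllipticOrderThree
import HarnessLib

/-!
# Twelve symmetries, six points: the Atkin–Lehner involution `w₂ = ρ(1 + i)` on the CM points of Lang's `(−1,3)` curve —
# on `Z(1)` it is `(τ_h τ_k)(w₃τ_h w₃τ_k)` fixing `[i]`, `[w₃i]`; on `Z(6)` it is `(τ₆ i√(2−√3))(τ₆″ w₃τ₆″)(w₃τ₆ w₃i√(2−√3))`
# with no fixed class, while `w₆σ²` fixes `[τ₆]`; on `Z(3)` it swaps the two order-three elliptic points of `X₆`,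
# `w₂(P₄) = P₂`, while `σ`, `w₃` fix `[τ₃]` — the orbits of `D₆ = ⟨σ, w₂, w₃⟩` are `D₆/⟨w₂⟩`, `D₆/⟨w₆σ²⟩`, `D₆/⟨σ, w₃⟩`
# (KRY 2006 §3.4 Remark 3.4.7, (3.4.13); Ogg 1983 §2; Bayer–Travesa 2007 §1–§2)

[tag: complex_torus] [tag: abelian_surface] [tag: quaternion_multiplication] [tag: complex_multiplication]
[tag: shimura_curve] [tag: special_cycles] [tag: atkin_lehner] [tag: elliptic_points]

Lane `lit-hodgefound`, seat p12, row g30-#8 — THEOREMS ONLY (no definition, no named fact, no instance); the sequel of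
g29-#5 (`w₂ = ρ(1 + i)`: `moebius_rho_ad_one_add_i_fixed`, `w₂τ_h = τ_k`, `w₂τ₆ = i√(2−√3)`), g29-#6/#7 (`w₃ = ρ(μ)`, the six
`Γ`-inequivalent points of `Z(1)` and of `Z(6)`: `zOne_six_points`, `zSix_six_points`), g30-#3 (`σ`: `zOne_one_orbit`,
`zSix_one_orbit`, `isRhoIsomorphic_of_conj_norm_one`), g30-#5 (`P₂`, `στ₃ ≅_ρ τ₃`, `τ₃ ≇_ρ P₂`), g30-#7 (the dihedral
relations). `IsRhoIsomorphic` = isomorphism of QM surfaces = `Γ`-equivalence (`Γ = ρ(𝔬¹)`, Lang IX Thm. 5.1 / KRY Prop. 3.2.1).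

## The print, VERBATIM

* S. Kudla, M. Rapoport, T. Yang (2006) [KudlaRapoportYang2006] §3.4 Remark 3.4.7 «the group of Atkin–Lehner involutions
  permutes the components transitively»; (3.4.13) «`Z(t)(ℂ) = Σ_{x ∈ L(t) mod Γ} pr(D_x)`»; §3.2 Prop. 3.2.1.
* A. P. Ogg (1983) [Ogg1983RealPoints] §2 p. 283 («`μ` defines an automorphism `w(m)` … `W = {w(m) : m ∥ DF}`»).
* P. Bayer, A. Travesa (2007) [BayerTravesa2007] §1 Thm. 1.1 («`P₂, P₄` are elliptic of order `3`»), Table 1, and §2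
  («`X₆^{(d)} := X₆/⟨ω_d⟩`», the quotients by the Atkin–Lehner involutions).
* S. Lang (1982) [Lang1982AbelianFunctions] Ch. IX §5 Thm. 5.1.

## What is proved

* §1 DESCENT: **a normalising element `α` of positive norm preserves `ρ`-isomorphism** (`IsRhoIsomorphic.of_normaliser`:
  `αε = ε′α` with `ε′ ∈ 𝔬`, `nr ε′ = nr ε`), hence **`IsRhoIsomorphic.w2`, `IsRhoIsomorphic.w3`** (`σ`: g30-#3).
* §2 the conjugating units (`i`, `2 + 3i + 2j`, `3 + 2i + 2j`, `−4 − j − 2ij`, `−4i − j − 2ij`, all in `𝔬¹`) and the identities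
  `e·Ad(1 + i)x·ē = y` for the nine non-trivial `w₂`-arrows (`Ad(1 + i)(x₁, x₂, x₃) = (x₁, −x₃, x₂)`).
* §3 **`Z(1)`: `w₂τ_k ≅_ρ τ_h`, `w₂(w₃i) ≅_ρ w₃i`, `w₂(w₃τ_h) ≅_ρ w₃τ_k`, `w₂(w₃τ_k) ≅_ρ w₃τ_h`** (with the tree's `w₂i = i`,
  `w₂τ_h = τ_k`): the permutation `(τ_h τ_k)(w₃τ_h w₃τ_k)`.
* §4 **`Z(6)`: `w₂(i√(2−√3)) ≅_ρ τ₆`, `w₂τ₆″ ≅_ρ w₃τ₆″`, `w₂(w₃τ₆) ≅_ρ w₃ i√(2−√3)`, `w₂(w₃ i√(2−√3)) ≅_ρ w₃τ₆`,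
  `w₂(w₃τ₆″) ≅_ρ τ₆″`** (with the tree's `w₂τ₆ = i√(2−√3)`): the permutation `(τ₆ i√(2−√3))(τ₆″ w₃τ₆″)(w₃τ₆ w₃ i√(2−√3))`.
* §5 **FIXED CLASSES: on `Z(1)`, `w₂` fixes `[i]` and `[w₃i]` and moves `[τ_h]`, `[w₃τ_h]`; on `Z(6)`, `w₂` fixes none of
  `[τ₆]`, `[τ₆″]`, `[w₃τ₆]`; and `w₂w₃σστ₆ ≅_ρ τ₆`** (`w₆σ²` stabilises `[τ₆]`: `σ²τ₆ ≅ w₃ i√(2−√3)`, `w₃w₃ = ρ(5 + 2j + 2ij)`,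
  `w₂ i√(2−√3) ≅ τ₆`) — `Z(1) ≅ D₆/⟨w₂⟩`, `Z(6) ≅ D₆/⟨w₆σ²⟩` as `D₆`-sets.
* §6 **`Z(3)`: `w₂τ₃ = P₂` EXACTLY** (`Ad(1 + i)(3i + j + ij) = 3i − j + ij`, uniqueness of the fixed point) — the Atkin–Lehner
  involution `w₂` swaps the two order-three elliptic points `P₄`, `P₂` of `X₆`; **`w₃τ₃ ≅_ρ τ₃`** (`Ad(μ)x = 15i + 7j − 5ij`,
  unit `2 − 3i − 2j`); with `στ₃ ≅_ρ τ₃` and `τ₃ ≇_ρ P₂` (g30-#5): the `D₆`-orbit of `[τ₃]` is `{[P₄], [P₂]} ≅ D₆/⟨σ, w₃⟩`.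

## Honest scope

All statements are about the twelve (`Z(1)`, `Z(6)`) resp. two (`Z(3)`) known classes; no claim that they exhaust `L(t)/Γ`.
«`Z(1) ≅ D₆/⟨w₂⟩`» etc. summarise the proved arrows and (non-)fixed classes; no group action on a quotient TYPE is
constructed, and `D₆` itself is the bookkeeping of g30-#7 (not a Lean group). 0 definitions, 0 named facts, 0 instances —
net debt `0`.

## References
* [KudlaRapoportYang2006] S. Kudla, M. Rapoport, T. Yang, *Modular Forms and Special Cycles on Shimura Curves* (2006), §3.2
  Prop. 3.2.1, §3.4 Remark 3.4.7, (3.4.9), (3.4.13).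
* [Ogg1983RealPoints] A. P. Ogg, *Real points on Shimura curves* (1983), §2 p. 283.
* [BayerTravesa2007] P. Bayer, A. Travesa, *Uniformizing functions for certain Shimura curves, in the case D = 6* (2007),
  §1 Thm. 1.1, Table 1, §2.
* [Lang1982AbelianFunctions] S. Lang, *Introduction to Algebraic and Abelian Functions*, 2nd ed. (1982), Ch. IX §5 Thm. 5.1.
-/

noncomputable section

set_option maxSynthPendingDepth 3

open Complex Module Matrix Quaternion Function
open scoped ComplexConjugate

namespace Literature.Geometry.Kaehler.ComplexTorus.QuaternionType

/-! ## §1 Normalisers descend to `Γ∖𝔥`: `w₂`, `w₃` (and `σ`) preserve `ρ`-isomorphism -/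

section Descent

/-- **A normalising element of positive norm descends to `Γ∖𝔥`**: if `nr α > 0` and `Ad(α)` maps `𝔬` to `𝔬` preserving norms
(`αε = ε′α`, `ε′ε̄′ = εε̄`), then `(A(z₁), ρ) ≅ (A(z₂), ρ) ⟹ (A(ρ(α)z₁), ρ) ≅ (A(ρ(α)z₂), ρ)` (`ρ(ε′)ρ(α) = ρ(α)ρ(ε)`).
[cite: Ogg1983RealPoints, §2 p. 283 («`𝒪^× = μ𝒪^×μ⁻¹` … hence `μ` defines an automorphism `w(m)`»)] [cite: KudlaRapoportYang2006, §3.2 Prop. 3.2.1] -/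
theorem IsRhoIsomorphic.of_normaliser {α : ℍ[ℚ,((-1 : ℤ) : ℚ),((3 : ℤ) : ℚ)]} (hα : 0 < (α * star α).re)
    (had : ∀ ε ∈ order (-1) 3, ∃ ε' ∈ order (-1) 3, α * ε = ε' * α ∧ ε' * star ε' = ε * star ε)
    {z₁ z₂ : ℂ} (hz₁ : 0 < z₁.im) (hz₂ : 0 < z₂.im)
    (h : IsRhoIsomorphic (a := -1) (b := 3) (by norm_num) (by norm_num) hz₁.ne' hz₂.ne') :
    IsRhoIsomorphic (a := -1) (b := 3) (by norm_num) (by norm_num)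
      (im_moebius_pos_of_det_pos (N := rho (-1) 3 (by norm_num) (castQ (-1) 3 α))
        (by rw [det_rho_castQ]; exact_mod_cast hα) ⟨z₁, hz₁⟩).ne'
      (im_moebius_pos_of_det_pos (N := rho (-1) 3 (by norm_num) (castQ (-1) 3 α))
        (by rw [det_rho_castQ]; exact_mod_cast hα) ⟨z₂, hz₂⟩).ne' := by
  obtain ⟨ε, hε, hunit, hmob⟩ :=
    (isRhoIsomorphic_iff_exists_unit_pm (a := -1) (b := 3) (by norm_num) (by norm_num) hz₁.ne' hz₂.ne').1 h
  obtain ⟨ε', hε', hcomm, hnorm⟩ := had ε hε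
  have hunit' : ε' * star ε' = 1 ∨ ε' * star ε' = -1 := by rw [hnorm]; exact hunit
  have hεne : (ε * star ε).re ≠ 0 := by
    rcases hunit with hu | hu
    · rw [hu, QuaternionAlgebra.re_one]; exact one_ne_zero
    · rw [hu, QuaternionAlgebra.re_neg, QuaternionAlgebra.re_one]; norm_num
  refine (isRhoIsomorphic_iff_exists_unit_pm (a := -1) (b := 3) (by norm_num) (by norm_num) _ _).2
    ⟨ε', hε', hunit', ?_⟩
  change moebius _ (moebius _ z₁) = moebius _ z₂
  rw [← moebius_mul_of_denom_ne_zero _ _ (rho_denom_ne_zero (a := -1) (b := 3) (hb := by norm_num) hz₁.ne' hα.ne'),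
    ← map_mul, ← castQ_mul, ← hcomm, castQ_mul, map_mul,
    moebius_mul_of_denom_ne_zero _ _ (rho_denom_ne_zero (a := -1) (b := 3) (hb := by norm_num) hz₁.ne' hεne), hmob]

/-- **`w₂` descends**: `(A(z₁), ρ) ≅ (A(z₂), ρ) ⟹ (A(w₂z₁), ρ) ≅ (A(w₂z₂), ρ)` (`Ad(1 + i)ε = (ε₀, ε₁, −ε₃, ε₂)`).
[cite: Ogg1983RealPoints, §2 p. 283] [cite: KudlaRapoportYang2006, §3.4 Remark 3.4.7] -/
theorem IsRhoIsomorphic.w2 {z₁ z₂ : ℂ} (hz₁ : 0 < z₁.im) (hz₂ : 0 < z₂.im)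
    (h : IsRhoIsomorphic (a := -1) (b := 3) (by norm_num) (by norm_num) hz₁.ne' hz₂.ne') :
    IsRhoIsomorphic (a := -1) (b := 3) (by norm_num) (by norm_num) (im_w2_coe_pos ⟨z₁, hz₁⟩).ne'
      (im_w2_coe_pos ⟨z₂, hz₂⟩).ne' := by
  have hα : (0 : ℚ) < ((⟨1, 1, 0, 0⟩ : ℍ[ℚ,((-1 : ℤ) : ℚ),((3 : ℤ) : ℚ)]) * star ⟨1, 1, 0, 0⟩).re := by
    rw [norm_one_add_i]; norm_num
  have had : ∀ ε ∈ order (-1) 3, ∃ ε' ∈ order (-1) 3,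
      (⟨1, 1, 0, 0⟩ : ℍ[ℚ,((-1 : ℤ) : ℚ),((3 : ℤ) : ℚ)]) * ε = ε' * ⟨1, 1, 0, 0⟩ ∧ ε' * star ε' = ε * star ε := by
    intro ε hε
    refine ⟨⟨ε.re, ε.imI, -ε.imK, ε.imJ⟩, ?_, one_add_i_mul ε, ?_⟩
    · obtain ⟨m, rfl⟩ := hε
      rw [ad_one_add_i_ofCoords]; exact ofCoords_intCast_mem_order _ _ _
    · obtain ⟨e₀, e₁, e₂, e₃⟩ := ε
      simp only [QuaternionAlgebra.star_mk, QuaternionAlgebra.mk_mul_mk]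
      ext <;> simp <;> ring
  exact IsRhoIsomorphic.of_normaliser hα had hz₁ hz₂ h

/-- **`w₃` descends**: `(A(z₁), ρ) ≅ (A(z₂), ρ) ⟹ (A(w₃z₁), ρ) ≅ (A(w₃z₂), ρ)`. [cite: Ogg1983RealPoints, §2 p. 283] [cite: KudlaRapoportYang2006, §3.4 Remark 3.4.7] -/
theorem IsRhoIsomorphic.w3 {z₁ z₂ : ℂ} (hz₁ : 0 < z₁.im) (hz₂ : 0 < z₂.im)
    (h : IsRhoIsomorphic (a := -1) (b := 3) (by norm_num) (by norm_num) hz₁.ne' hz₂.ne') :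
    IsRhoIsomorphic (a := -1) (b := 3) (by norm_num) (by norm_num) (im_w3_coe_pos ⟨z₁, hz₁⟩).ne'
      (im_w3_coe_pos ⟨z₂, hz₂⟩).ne' := by
  have hα : (0 : ℚ) < ((⟨3, 0, 1, 1⟩ : ℍ[ℚ,((-1 : ℤ) : ℚ),((3 : ℤ) : ℚ)]) * star ⟨3, 0, 1, 1⟩).re := by
    rw [norm_three_add_j_add_ij]; norm_num
  have had : ∀ ε ∈ order (-1) 3, ∃ ε' ∈ order (-1) 3,
      (⟨3, 0, 1, 1⟩ : ℍ[ℚ,((-1 : ℤ) : ℚ),((3 : ℤ) : ℚ)]) * ε = ε' * ⟨3, 0, 1, 1⟩ ∧ ε' * star ε' = ε * star ε := by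
    intro ε hε
    refine ⟨⟨ε.re, 5 * ε.imI + 6 * ε.imJ - 6 * ε.imK, 2 * ε.imI + 3 * ε.imJ - 2 * ε.imK,
      -2 * ε.imI - 2 * ε.imJ + 3 * ε.imK⟩, ?_, three_add_j_add_ij_mul ε, ?_⟩
    · obtain ⟨m, rfl⟩ := hε
      rw [ad_three_add_j_add_ij_ofCoords]; exact ofCoords_intCast_mem_order _ _ _
    · obtain ⟨e₀, e₁, e₂, e₃⟩ := ε
      simp only [QuaternionAlgebra.star_mk, QuaternionAlgebra.mk_mul_mk]
      ext <;> simp <;> ring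
  exact IsRhoIsomorphic.of_normaliser hα had hz₁ hz₂ h

/-- `Im i > 0` (private helper used inside statements as a proof term). [folklore] -/
private theorem complexI_im_pos' : 0 < (I : ℂ).im := by simp

/-- Equal points are `ρ`-isomorphic (bookkeeping). [cite: Lang1982AbelianFunctions, Ch. IX §5 Thm. 5.1] -/
private theorem isRhoIsomorphic_of_eq' {z₁ z₂ : ℂ} (hz₁ : z₁.im ≠ 0) (hz₂ : z₂.im ≠ 0) (e : z₁ = z₂) :
    IsRhoIsomorphic (a := -1) (b := 3) (by norm_num) (by norm_num) hz₁ hz₂ := by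
  subst e
  exact IsRhoIsomorphic.refl _ _ hz₁

end Descent

/-! ## §2 The unit witnesses for `w₂`: `e·(Ad(1 + i)x)·ē = y`, `eē = 1` -/

section WitnessesW2

/-- The conjugating units for the `w₂`-arrows lie in `𝔬` and have norm one. [cite: Lang1982AbelianFunctions, Ch. IX §5 Thm. 5.1] -/
theorem w2Units_mem_and_norm :
    ((⟨0, 1, 0, 0⟩ : ℍ[ℚ,((-1 : ℤ) : ℚ),((3 : ℤ) : ℚ)]) ∈ order (-1) 3 ∧ (⟨0, 1, 0, 0⟩ : ℍ[ℚ,((-1 : ℤ) : ℚ),((3 : ℤ) : ℚ)]) * star ⟨0, 1, 0, 0⟩ = 1) ∧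
    ((⟨2, 3, 2, 0⟩ : ℍ[ℚ,((-1 : ℤ) : ℚ),((3 : ℤ) : ℚ)]) ∈ order (-1) 3 ∧ (⟨2, 3, 2, 0⟩ : ℍ[ℚ,((-1 : ℤ) : ℚ),((3 : ℤ) : ℚ)]) * star ⟨2, 3, 2, 0⟩ = 1) ∧
    ((⟨3, 2, 2, 0⟩ : ℍ[ℚ,((-1 : ℤ) : ℚ),((3 : ℤ) : ℚ)]) ∈ order (-1) 3 ∧ (⟨3, 2, 2, 0⟩ : ℍ[ℚ,((-1 : ℤ) : ℚ),((3 : ℤ) : ℚ)]) * star ⟨3, 2, 2, 0⟩ = 1) ∧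
    ((⟨-4, 0, -1, -2⟩ : ℍ[ℚ,((-1 : ℤ) : ℚ),((3 : ℤ) : ℚ)]) ∈ order (-1) 3 ∧ (⟨-4, 0, -1, -2⟩ : ℍ[ℚ,((-1 : ℤ) : ℚ),((3 : ℤ) : ℚ)]) * star ⟨-4, 0, -1, -2⟩ = 1) ∧
    ((⟨0, -4, -1, -2⟩ : ℍ[ℚ,((-1 : ℤ) : ℚ),((3 : ℤ) : ℚ)]) ∈ order (-1) 3 ∧ (⟨0, -4, -1, -2⟩ : ℍ[ℚ,((-1 : ℤ) : ℚ),((3 : ℤ) : ℚ)]) * star ⟨0, -4, -1, -2⟩ = 1) := by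
  refine ⟨⟨⟨![0, 1, 0, 0], by ext <;> simp [ofCoords]⟩, ?_⟩, ⟨⟨![2, 3, 2, 0], by ext <;> simp [ofCoords]⟩, ?_⟩, ⟨⟨![3, 2, 2, 0], by ext <;> simp [ofCoords]⟩, ?_⟩, ⟨⟨![-4, 0, -1, -2], by ext <;> simp [ofCoords]⟩, ?_⟩, ⟨⟨![0, -4, -1, -2], by ext <;> simp [ofCoords]⟩, ?_⟩⟩ <;>
    rw [QuaternionAlgebra.star_mk, QuaternionAlgebra.mk_mul_mk] <;> ext <;> norm_num

/-- **`e·(Ad(1 + i)x)·ē = y`** for the nine non-trivial `w₂`-arrows (`Ad(1 + i)(x₁, x₂, x₃) = (x₁, −x₃, x₂)`). [cite: KudlaRapoportYang2006, §3.4 (3.4.13)] [cite: Ogg1983RealPoints, §2 p. 283] -/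
theorem w2_witness_conj :
    (⟨0, 1, 0, 0⟩ : ℍ[ℚ,((-1 : ℤ) : ℚ),((3 : ℤ) : ℚ)]) * ⟨0, 2, -1, 0⟩ * star ⟨0, 1, 0, 0⟩ = (⟨0, 2, 1, 0⟩ : ℍ[ℚ,((-1 : ℤ) : ℚ),((3 : ℤ) : ℚ)]) ∧
    (⟨2, 3, 2, 0⟩ : ℍ[ℚ,((-1 : ℤ) : ℚ),((3 : ℤ) : ℚ)]) * ⟨0, 5, 2, 2⟩ * star ⟨2, 3, 2, 0⟩ = (⟨0, 5, 2, -2⟩ : ℍ[ℚ,((-1 : ℤ) : ℚ),((3 : ℤ) : ℚ)]) ∧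
    (⟨3, 2, 2, 0⟩ : ℍ[ℚ,((-1 : ℤ) : ℚ),((3 : ℤ) : ℚ)]) * ⟨0, 16, 6, 7⟩ * star ⟨3, 2, 2, 0⟩ = (⟨0, 4, 2, -1⟩ : ℍ[ℚ,((-1 : ℤ) : ℚ),((3 : ℤ) : ℚ)]) ∧
    (⟨2, 3, 2, 0⟩ : ℍ[ℚ,((-1 : ℤ) : ℚ),((3 : ℤ) : ℚ)]) * ⟨0, 4, 1, 2⟩ * star ⟨2, 3, 2, 0⟩ = (⟨0, 16, 7, -6⟩ : ℍ[ℚ,((-1 : ℤ) : ℚ),((3 : ℤ) : ℚ)]) ∧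
    (⟨0, 1, 0, 0⟩ : ℍ[ℚ,((-1 : ℤ) : ℚ),((3 : ℤ) : ℚ)]) * ⟨0, 3, -1, 0⟩ * star ⟨0, 1, 0, 0⟩ = (⟨0, 3, 1, 0⟩ : ℍ[ℚ,((-1 : ℤ) : ℚ),((3 : ℤ) : ℚ)]) ∧
    (⟨-4, 0, -1, -2⟩ : ℍ[ℚ,((-1 : ℤ) : ℚ),((3 : ℤ) : ℚ)]) * ⟨0, 6, -3, 1⟩ * star ⟨-4, 0, -1, -2⟩ = (⟨0, 18, 9, -5⟩ : ℍ[ℚ,((-1 : ℤ) : ℚ),((3 : ℤ) : ℚ)]) ∧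
    (⟨3, 2, 2, 0⟩ : ℍ[ℚ,((-1 : ℤ) : ℚ),((3 : ℤ) : ℚ)]) * ⟨0, 21, 8, 9⟩ * star ⟨3, 2, 2, 0⟩ = (⟨0, 9, 4, -3⟩ : ℍ[ℚ,((-1 : ℤ) : ℚ),((3 : ℤ) : ℚ)]) ∧
    (⟨2, 3, 2, 0⟩ : ℍ[ℚ,((-1 : ℤ) : ℚ),((3 : ℤ) : ℚ)]) * ⟨0, 9, 3, 4⟩ * star ⟨2, 3, 2, 0⟩ = (⟨0, 21, 9, -8⟩ : ℍ[ℚ,((-1 : ℤ) : ℚ),((3 : ℤ) : ℚ)]) ∧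
    (⟨0, -4, -1, -2⟩ : ℍ[ℚ,((-1 : ℤ) : ℚ),((3 : ℤ) : ℚ)]) * ⟨0, 18, 5, 9⟩ * star ⟨0, -4, -1, -2⟩ = (⟨0, 6, 1, 3⟩ : ℍ[ℚ,((-1 : ℤ) : ℚ),((3 : ℤ) : ℚ)]) := by
  refine ⟨?_, ?_, ?_, ?_, ?_, ?_, ?_, ?_, ?_⟩ <;>
    rw [QuaternionAlgebra.star_mk, QuaternionAlgebra.mk_mul_mk, QuaternionAlgebra.mk_mul_mk] <;> ext <;> norm_num

end WitnessesW2

/-! ## §3 `w₂` on the six points of `Z(1)`: `(τ_h τ_k)(w₃τ_h w₃τ_k)`, fixing the classes of `i` and `w₃i` -/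

section WTwoZOne

/-- **`w₂(τ_k) ≅_ρ τ_h`**: `ρ(Ad(1+i)x)` fixes `w₂(z_x)` for `x = (2, 0, 1)`, `Ad(1+i)x = (2, -1, 0)`, and the norm-one unit `(0, 1, 0, 0)` conjugates it to the special vector `(2, 1, 0)` of `τ_h`. [cite: KudlaRapoportYang2006, §3.2 Prop. 3.2.1 and §3.4 (3.4.9), (3.4.13)] [cite: Ogg1983RealPoints, §2 p. 283] -/
theorem isRhoIsomorphic_w2_tauK_tauHex :
    IsRhoIsomorphic (a := -1) (b := 3) (by norm_num) (by norm_num) (im_w2_coe_pos ⟨⟨0, 2 - Real.sqrt 3⟩, tauK_im_pos⟩).ne' tauHex_im_pos.ne' := by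
  have hfix : moebius (rho (-1) 3 (by norm_num) (castQ (-1) 3 (⟨0, 2, -1, 0⟩ : ℍ[ℚ,((-1 : ℤ) : ℚ),((3 : ℤ) : ℚ)])))
      (moebius (rho (-1) 3 (by norm_num) (castQ (-1) 3 (⟨1, 1, 0, 0⟩ : ℍ[ℚ,((-1 : ℤ) : ℚ),((3 : ℤ) : ℚ)]))) ((⟨⟨0, 2 - Real.sqrt 3⟩, tauK_im_pos⟩ : UpperHalfPlane) : ℂ)) =
      moebius (rho (-1) 3 (by norm_num) (castQ (-1) 3 (⟨1, 1, 0, 0⟩ : ℍ[ℚ,((-1 : ℤ) : ℚ),((3 : ℤ) : ℚ)]))) ((⟨⟨0, 2 - Real.sqrt 3⟩, tauK_im_pos⟩ : UpperHalfPlane) : ℂ) :=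
    moebius_rho_ad_one_add_i_fixed (x := (⟨0, 2, 0, 1⟩ : ℍ[ℚ,((-1 : ℤ) : ℚ),((3 : ℤ) : ℚ)])) ⟨⟨0, 2 - Real.sqrt 3⟩, tauK_im_pos⟩ moebius_rho_tauK
  exact isRhoIsomorphic_of_conj_norm_one (a := -1) (b := 3) (by norm_num) (by norm_num) (x := (⟨0, 2, -1, 0⟩ : ℍ[ℚ,((-1 : ℤ) : ℚ),((3 : ℤ) : ℚ)])) (y := ⟨0, 2, 1, 0⟩)
    (e := ⟨0, 1, 0, 0⟩) rfl (by rw [QuaternionAlgebra.star_mk, QuaternionAlgebra.mk_mul_mk]; norm_num) w2Units_mem_and_norm.1.1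
    w2Units_mem_and_norm.1.2 w2_witness_conj.1 (im_w2_coe_pos ⟨⟨0, 2 - Real.sqrt 3⟩, tauK_im_pos⟩) tauHex_im_pos hfix moebius_rho_two_i_add_j_tauHex

/-- **`w₂(w₃(i)) ≅_ρ w₃(i)`**: `ρ(Ad(1+i)x)` fixes `w₂(z_x)` for `x = (5, 2, -2)`, `Ad(1+i)x = (5, 2, 2)`, and the norm-one unit `(2, 3, 2, 0)` conjugates it to the special vector `(5, 2, -2)` of `w₃(i)`. [cite: KudlaRapoportYang2006, §3.2 Prop. 3.2.1 and §3.4 (3.4.9), (3.4.13)] [cite: Ogg1983RealPoints, §2 p. 283] -/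
theorem isRhoIsomorphic_w2_w3I_w3I :
    IsRhoIsomorphic (a := -1) (b := 3) (by norm_num) (by norm_num) (im_w2_coe_pos ⟨moebius (rho (-1) 3 (by norm_num) (castQ (-1) 3 (⟨3, 0, 1, 1⟩ : ℍ[ℚ,((-1 : ℤ) : ℚ),((3 : ℤ) : ℚ)]))) I, im_w3_I_pos⟩).ne' im_w3_I_pos.ne' := by
  have hfix : moebius (rho (-1) 3 (by norm_num) (castQ (-1) 3 (⟨0, 5, 2, 2⟩ : ℍ[ℚ,((-1 : ℤ) : ℚ),((3 : ℤ) : ℚ)])))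
      (moebius (rho (-1) 3 (by norm_num) (castQ (-1) 3 (⟨1, 1, 0, 0⟩ : ℍ[ℚ,((-1 : ℤ) : ℚ),((3 : ℤ) : ℚ)]))) ((⟨moebius (rho (-1) 3 (by norm_num) (castQ (-1) 3 (⟨3, 0, 1, 1⟩ : ℍ[ℚ,((-1 : ℤ) : ℚ),((3 : ℤ) : ℚ)]))) I, im_w3_I_pos⟩ : UpperHalfPlane) : ℂ)) =
      moebius (rho (-1) 3 (by norm_num) (castQ (-1) 3 (⟨1, 1, 0, 0⟩ : ℍ[ℚ,((-1 : ℤ) : ℚ),((3 : ℤ) : ℚ)]))) ((⟨moebius (rho (-1) 3 (by norm_num) (castQ (-1) 3 (⟨3, 0, 1, 1⟩ : ℍ[ℚ,((-1 : ℤ) : ℚ),((3 : ℤ) : ℚ)]))) I, im_w3_I_pos⟩ : UpperHalfPlane) : ℂ) :=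
    moebius_rho_ad_one_add_i_fixed (x := (⟨0, 5, 2, -2⟩ : ℍ[ℚ,((-1 : ℤ) : ℚ),((3 : ℤ) : ℚ)])) ⟨moebius (rho (-1) 3 (by norm_num) (castQ (-1) 3 (⟨3, 0, 1, 1⟩ : ℍ[ℚ,((-1 : ℤ) : ℚ),((3 : ℤ) : ℚ)]))) I, im_w3_I_pos⟩ moebius_rho_w3_I
  exact isRhoIsomorphic_of_conj_norm_one (a := -1) (b := 3) (by norm_num) (by norm_num) (x := (⟨0, 5, 2, 2⟩ : ℍ[ℚ,((-1 : ℤ) : ℚ),((3 : ℤ) : ℚ)])) (y := ⟨0, 5, 2, -2⟩)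
    (e := ⟨2, 3, 2, 0⟩) rfl (by rw [QuaternionAlgebra.star_mk, QuaternionAlgebra.mk_mul_mk]; norm_num) w2Units_mem_and_norm.2.1.1
    w2Units_mem_and_norm.2.1.2 w2_witness_conj.2.1 (im_w2_coe_pos ⟨moebius (rho (-1) 3 (by norm_num) (castQ (-1) 3 (⟨3, 0, 1, 1⟩ : ℍ[ℚ,((-1 : ℤ) : ℚ),((3 : ℤ) : ℚ)]))) I, im_w3_I_pos⟩) im_w3_I_pos hfix moebius_rho_w3_I

/-- **`w₂(w₃(τ_h)) ≅_ρ w₃(τ_k)`**: `ρ(Ad(1+i)x)` fixes `w₂(z_x)` for `x = (16, 7, -6)`, `Ad(1+i)x = (16, 6, 7)`, and the norm-one unit `(3, 2, 2, 0)` conjugates it to the special vector `(4, 2, -1)` of `w₃(τ_k)`. [cite: KudlaRapoportYang2006, §3.2 Prop. 3.2.1 and §3.4 (3.4.9), (3.4.13)] [cite: Ogg1983RealPoints, §2 p. 283] -/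
theorem isRhoIsomorphic_w2_w3tauHex_w3tauK :
    IsRhoIsomorphic (a := -1) (b := 3) (by norm_num) (by norm_num) (im_w2_coe_pos ⟨moebius (rho (-1) 3 (by norm_num) (castQ (-1) 3 (⟨3, 0, 1, 1⟩ : ℍ[ℚ,((-1 : ℤ) : ℚ),((3 : ℤ) : ℚ)]))) ⟨Real.sqrt 3 / 2, 1 / 2⟩, im_w3_tauHex_pos⟩).ne' im_w3_tauK_pos.ne' := by
  have hfix : moebius (rho (-1) 3 (by norm_num) (castQ (-1) 3 (⟨0, 16, 6, 7⟩ : ℍ[ℚ,((-1 : ℤ) : ℚ),((3 : ℤ) : ℚ)])))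
      (moebius (rho (-1) 3 (by norm_num) (castQ (-1) 3 (⟨1, 1, 0, 0⟩ : ℍ[ℚ,((-1 : ℤ) : ℚ),((3 : ℤ) : ℚ)]))) ((⟨moebius (rho (-1) 3 (by norm_num) (castQ (-1) 3 (⟨3, 0, 1, 1⟩ : ℍ[ℚ,((-1 : ℤ) : ℚ),((3 : ℤ) : ℚ)]))) ⟨Real.sqrt 3 / 2, 1 / 2⟩, im_w3_tauHex_pos⟩ : UpperHalfPlane) : ℂ)) =
      moebius (rho (-1) 3 (by norm_num) (castQ (-1) 3 (⟨1, 1, 0, 0⟩ : ℍ[ℚ,((-1 : ℤ) : ℚ),((3 : ℤ) : ℚ)]))) ((⟨moebius (rho (-1) 3 (by norm_num) (castQ (-1) 3 (⟨3, 0, 1, 1⟩ : ℍ[ℚ,((-1 : ℤ) : ℚ),((3 : ℤ) : ℚ)]))) ⟨Real.sqrt 3 / 2, 1 / 2⟩, im_w3_tauHex_pos⟩ : UpperHalfPlane) : ℂ) :=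
    moebius_rho_ad_one_add_i_fixed (x := (⟨0, 16, 7, -6⟩ : ℍ[ℚ,((-1 : ℤ) : ℚ),((3 : ℤ) : ℚ)])) ⟨moebius (rho (-1) 3 (by norm_num) (castQ (-1) 3 (⟨3, 0, 1, 1⟩ : ℍ[ℚ,((-1 : ℤ) : ℚ),((3 : ℤ) : ℚ)]))) ⟨Real.sqrt 3 / 2, 1 / 2⟩, im_w3_tauHex_pos⟩ moebius_rho_w3_tauHex
  exact isRhoIsomorphic_of_conj_norm_one (a := -1) (b := 3) (by norm_num) (by norm_num) (x := (⟨0, 16, 6, 7⟩ : ℍ[ℚ,((-1 : ℤ) : ℚ),((3 : ℤ) : ℚ)])) (y := ⟨0, 4, 2, -1⟩)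
    (e := ⟨3, 2, 2, 0⟩) rfl (by rw [QuaternionAlgebra.star_mk, QuaternionAlgebra.mk_mul_mk]; norm_num) w2Units_mem_and_norm.2.2.1.1
    w2Units_mem_and_norm.2.2.1.2 w2_witness_conj.2.2.1 (im_w2_coe_pos ⟨moebius (rho (-1) 3 (by norm_num) (castQ (-1) 3 (⟨3, 0, 1, 1⟩ : ℍ[ℚ,((-1 : ℤ) : ℚ),((3 : ℤ) : ℚ)]))) ⟨Real.sqrt 3 / 2, 1 / 2⟩, im_w3_tauHex_pos⟩) im_w3_tauK_pos hfix moebius_rho_w3_tauK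

/-- **`w₂(w₃(τ_k)) ≅_ρ w₃(τ_h)`**: `ρ(Ad(1+i)x)` fixes `w₂(z_x)` for `x = (4, 2, -1)`, `Ad(1+i)x = (4, 1, 2)`, and the norm-one unit `(2, 3, 2, 0)` conjugates it to the special vector `(16, 7, -6)` of `w₃(τ_h)`. [cite: KudlaRapoportYang2006, §3.2 Prop. 3.2.1 and §3.4 (3.4.9), (3.4.13)] [cite: Ogg1983RealPoints, §2 p. 283] -/
theorem isRhoIsomorphic_w2_w3tauK_w3tauHex :
    IsRhoIsomorphic (a := -1) (b := 3) (by norm_num) (by norm_num) (im_w2_coe_pos ⟨moebius (rho (-1) 3 (by norm_num) (castQ (-1) 3 (⟨3, 0, 1, 1⟩ : ℍ[ℚ,((-1 : ℤ) : ℚ),((3 : ℤ) : ℚ)]))) ⟨0, 2 - Real.sqrt 3⟩, im_w3_tauK_pos⟩).ne' im_w3_tauHex_pos.ne' := by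
  have hfix : moebius (rho (-1) 3 (by norm_num) (castQ (-1) 3 (⟨0, 4, 1, 2⟩ : ℍ[ℚ,((-1 : ℤ) : ℚ),((3 : ℤ) : ℚ)])))
      (moebius (rho (-1) 3 (by norm_num) (castQ (-1) 3 (⟨1, 1, 0, 0⟩ : ℍ[ℚ,((-1 : ℤ) : ℚ),((3 : ℤ) : ℚ)]))) ((⟨moebius (rho (-1) 3 (by norm_num) (castQ (-1) 3 (⟨3, 0, 1, 1⟩ : ℍ[ℚ,((-1 : ℤ) : ℚ),((3 : ℤ) : ℚ)]))) ⟨0, 2 - Real.sqrt 3⟩, im_w3_tauK_pos⟩ : UpperHalfPlane) : ℂ)) =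
      moebius (rho (-1) 3 (by norm_num) (castQ (-1) 3 (⟨1, 1, 0, 0⟩ : ℍ[ℚ,((-1 : ℤ) : ℚ),((3 : ℤ) : ℚ)]))) ((⟨moebius (rho (-1) 3 (by norm_num) (castQ (-1) 3 (⟨3, 0, 1, 1⟩ : ℍ[ℚ,((-1 : ℤ) : ℚ),((3 : ℤ) : ℚ)]))) ⟨0, 2 - Real.sqrt 3⟩, im_w3_tauK_pos⟩ : UpperHalfPlane) : ℂ) :=
    moebius_rho_ad_one_add_i_fixed (x := (⟨0, 4, 2, -1⟩ : ℍ[ℚ,((-1 : ℤ) : ℚ),((3 : ℤ) : ℚ)])) ⟨moebius (rho (-1) 3 (by norm_num) (castQ (-1) 3 (⟨3, 0, 1, 1⟩ : ℍ[ℚ,((-1 : ℤ) : ℚ),((3 : ℤ) : ℚ)]))) ⟨0, 2 - Real.sqrt 3⟩, im_w3_tauK_pos⟩ moebius_rho_w3_tauK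
  exact isRhoIsomorphic_of_conj_norm_one (a := -1) (b := 3) (by norm_num) (by norm_num) (x := (⟨0, 4, 1, 2⟩ : ℍ[ℚ,((-1 : ℤ) : ℚ),((3 : ℤ) : ℚ)])) (y := ⟨0, 16, 7, -6⟩)
    (e := ⟨2, 3, 2, 0⟩) rfl (by rw [QuaternionAlgebra.star_mk, QuaternionAlgebra.mk_mul_mk]; norm_num) w2Units_mem_and_norm.2.1.1
    w2Units_mem_and_norm.2.1.2 w2_witness_conj.2.2.2.1 (im_w2_coe_pos ⟨moebius (rho (-1) 3 (by norm_num) (castQ (-1) 3 (⟨3, 0, 1, 1⟩ : ℍ[ℚ,((-1 : ℤ) : ℚ),((3 : ℤ) : ℚ)]))) ⟨0, 2 - Real.sqrt 3⟩, im_w3_tauK_pos⟩) im_w3_tauHex_pos hfix moebius_rho_w3_tauHex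

end WTwoZOne

/-! ## §4 `w₂` on the six points of `Z(6)`: `(τ₆  i√(2−√3))(τ₆″  w₃τ₆″)(w₃τ₆  w₃ i√(2−√3))` — no fixed class -/

section WTwoZSix

/-- **`w₂(i√(2 − √3)) ≅_ρ τ₆`**: `ρ(Ad(1+i)x)` fixes `w₂(z_x)` for `x = (3, 0, 1)`, `Ad(1+i)x = (3, -1, 0)`, and the norm-one unit `(0, 1, 0, 0)` conjugates it to the special vector `(3, 1, 0)` of `τ₆`. [cite: KudlaRapoportYang2006, §3.2 Prop. 3.2.1 and §3.4 (3.4.9), (3.4.13)] [cite: Ogg1983RealPoints, §2 p. 283] -/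
theorem isRhoIsomorphic_w2_axis_tauSix :
    IsRhoIsomorphic (a := -1) (b := 3) (by norm_num) (by norm_num) (im_w2_coe_pos ⟨(((Real.sqrt (2 - Real.sqrt 3) : ℝ) : ℂ) * I), im_axis_pos⟩).ne' tauSix_im_pos.ne' := by
  have hfix : moebius (rho (-1) 3 (by norm_num) (castQ (-1) 3 (⟨0, 3, -1, 0⟩ : ℍ[ℚ,((-1 : ℤ) : ℚ),((3 : ℤ) : ℚ)])))
      (moebius (rho (-1) 3 (by norm_num) (castQ (-1) 3 (⟨1, 1, 0, 0⟩ : ℍ[ℚ,((-1 : ℤ) : ℚ),((3 : ℤ) : ℚ)]))) ((⟨(((Real.sqrt (2 - Real.sqrt 3) : ℝ) : ℂ) * I), im_axis_pos⟩ : UpperHalfPlane) : ℂ)) =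
      moebius (rho (-1) 3 (by norm_num) (castQ (-1) 3 (⟨1, 1, 0, 0⟩ : ℍ[ℚ,((-1 : ℤ) : ℚ),((3 : ℤ) : ℚ)]))) ((⟨(((Real.sqrt (2 - Real.sqrt 3) : ℝ) : ℂ) * I), im_axis_pos⟩ : UpperHalfPlane) : ℂ) :=
    moebius_rho_ad_one_add_i_fixed (x := (⟨0, 3, 0, 1⟩ : ℍ[ℚ,((-1 : ℤ) : ℚ),((3 : ℤ) : ℚ)])) ⟨(((Real.sqrt (2 - Real.sqrt 3) : ℝ) : ℂ) * I), im_axis_pos⟩ moebius_rho_three_i_add_ij_axis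
  exact isRhoIsomorphic_of_conj_norm_one (a := -1) (b := 3) (by norm_num) (by norm_num) (x := (⟨0, 3, -1, 0⟩ : ℍ[ℚ,((-1 : ℤ) : ℚ),((3 : ℤ) : ℚ)])) (y := ⟨0, 3, 1, 0⟩)
    (e := ⟨0, 1, 0, 0⟩) rfl (by rw [QuaternionAlgebra.star_mk, QuaternionAlgebra.mk_mul_mk]; norm_num) w2Units_mem_and_norm.1.1
    w2Units_mem_and_norm.1.2 w2_witness_conj.2.2.2.2.1 (im_w2_coe_pos ⟨(((Real.sqrt (2 - Real.sqrt 3) : ℝ) : ℂ) * I), im_axis_pos⟩) tauSix_im_pos hfix moebius_rho_tauSix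

/-- **`w₂(τ₆″) ≅_ρ w₃(τ₆″)`**: `ρ(Ad(1+i)x)` fixes `w₂(z_x)` for `x = (6, 1, 3)`, `Ad(1+i)x = (6, -3, 1)`, and the norm-one unit `(-4, 0, -1, -2)` conjugates it to the special vector `(18, 9, -5)` of `w₃(τ₆″)`. [cite: KudlaRapoportYang2006, §3.2 Prop. 3.2.1 and §3.4 (3.4.9), (3.4.13)] [cite: Ogg1983RealPoints, §2 p. 283] -/
theorem isRhoIsomorphic_w2_tauSixBis_w3tauSixBis :
    IsRhoIsomorphic (a := -1) (b := 3) (by norm_num) (by norm_num) (im_w2_coe_pos ⟨⟨Real.sqrt 3 / (6 + 3 * Real.sqrt 3), Real.sqrt 6 / (6 + 3 * Real.sqrt 3)⟩, tauSixBis_im_pos⟩).ne' im_w3_tauSixBis_pos.ne' := by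
  have hfix : moebius (rho (-1) 3 (by norm_num) (castQ (-1) 3 (⟨0, 6, -3, 1⟩ : ℍ[ℚ,((-1 : ℤ) : ℚ),((3 : ℤ) : ℚ)])))
      (moebius (rho (-1) 3 (by norm_num) (castQ (-1) 3 (⟨1, 1, 0, 0⟩ : ℍ[ℚ,((-1 : ℤ) : ℚ),((3 : ℤ) : ℚ)]))) ((⟨⟨Real.sqrt 3 / (6 + 3 * Real.sqrt 3), Real.sqrt 6 / (6 + 3 * Real.sqrt 3)⟩, tauSixBis_im_pos⟩ : UpperHalfPlane) : ℂ)) =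
      moebius (rho (-1) 3 (by norm_num) (castQ (-1) 3 (⟨1, 1, 0, 0⟩ : ℍ[ℚ,((-1 : ℤ) : ℚ),((3 : ℤ) : ℚ)]))) ((⟨⟨Real.sqrt 3 / (6 + 3 * Real.sqrt 3), Real.sqrt 6 / (6 + 3 * Real.sqrt 3)⟩, tauSixBis_im_pos⟩ : UpperHalfPlane) : ℂ) :=
    moebius_rho_ad_one_add_i_fixed (x := (⟨0, 6, 1, 3⟩ : ℍ[ℚ,((-1 : ℤ) : ℚ),((3 : ℤ) : ℚ)])) ⟨⟨Real.sqrt 3 / (6 + 3 * Real.sqrt 3), Real.sqrt 6 / (6 + 3 * Real.sqrt 3)⟩, tauSixBis_im_pos⟩ moebius_rho_tauSixBis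
  exact isRhoIsomorphic_of_conj_norm_one (a := -1) (b := 3) (by norm_num) (by norm_num) (x := (⟨0, 6, -3, 1⟩ : ℍ[ℚ,((-1 : ℤ) : ℚ),((3 : ℤ) : ℚ)])) (y := ⟨0, 18, 9, -5⟩)
    (e := ⟨-4, 0, -1, -2⟩) rfl (by rw [QuaternionAlgebra.star_mk, QuaternionAlgebra.mk_mul_mk]; norm_num) w2Units_mem_and_norm.2.2.2.1.1
    w2Units_mem_and_norm.2.2.2.1.2 w2_witness_conj.2.2.2.2.2.1 (im_w2_coe_pos ⟨⟨Real.sqrt 3 / (6 + 3 * Real.sqrt 3), Real.sqrt 6 / (6 + 3 * Real.sqrt 3)⟩, tauSixBis_im_pos⟩) im_w3_tauSixBis_pos hfix moebius_rho_w3_tauSixBis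

/-- **`w₂(w₃(τ₆)) ≅_ρ w₃(i√(2−√3))`**: `ρ(Ad(1+i)x)` fixes `w₂(z_x)` for `x = (21, 9, -8)`, `Ad(1+i)x = (21, 8, 9)`, and the norm-one unit `(3, 2, 2, 0)` conjugates it to the special vector `(9, 4, -3)` of `w₃(i√(2−√3))`. [cite: KudlaRapoportYang2006, §3.2 Prop. 3.2.1 and §3.4 (3.4.9), (3.4.13)] [cite: Ogg1983RealPoints, §2 p. 283] -/
theorem isRhoIsomorphic_w2_w3tauSix_w3axis :
    IsRhoIsomorphic (a := -1) (b := 3) (by norm_num) (by norm_num) (im_w2_coe_pos ⟨moebius (rho (-1) 3 (by norm_num) (castQ (-1) 3 (⟨3, 0, 1, 1⟩ : ℍ[ℚ,((-1 : ℤ) : ℚ),((3 : ℤ) : ℚ)]))) ⟨Real.sqrt 3 / 3, Real.sqrt 6 / 3⟩, im_w3_tauSix_pos⟩).ne' im_w3_axis_pos.ne' := by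
  have hfix : moebius (rho (-1) 3 (by norm_num) (castQ (-1) 3 (⟨0, 21, 8, 9⟩ : ℍ[ℚ,((-1 : ℤ) : ℚ),((3 : ℤ) : ℚ)])))
      (moebius (rho (-1) 3 (by norm_num) (castQ (-1) 3 (⟨1, 1, 0, 0⟩ : ℍ[ℚ,((-1 : ℤ) : ℚ),((3 : ℤ) : ℚ)]))) ((⟨moebius (rho (-1) 3 (by norm_num) (castQ (-1) 3 (⟨3, 0, 1, 1⟩ : ℍ[ℚ,((-1 : ℤ) : ℚ),((3 : ℤ) : ℚ)]))) ⟨Real.sqrt 3 / 3, Real.sqrt 6 / 3⟩, im_w3_tauSix_pos⟩ : UpperHalfPlane) : ℂ)) =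
      moebius (rho (-1) 3 (by norm_num) (castQ (-1) 3 (⟨1, 1, 0, 0⟩ : ℍ[ℚ,((-1 : ℤ) : ℚ),((3 : ℤ) : ℚ)]))) ((⟨moebius (rho (-1) 3 (by norm_num) (castQ (-1) 3 (⟨3, 0, 1, 1⟩ : ℍ[ℚ,((-1 : ℤ) : ℚ),((3 : ℤ) : ℚ)]))) ⟨Real.sqrt 3 / 3, Real.sqrt 6 / 3⟩, im_w3_tauSix_pos⟩ : UpperHalfPlane) : ℂ) :=
    moebius_rho_ad_one_add_i_fixed (x := (⟨0, 21, 9, -8⟩ : ℍ[ℚ,((-1 : ℤ) : ℚ),((3 : ℤ) : ℚ)])) ⟨moebius (rho (-1) 3 (by norm_num) (castQ (-1) 3 (⟨3, 0, 1, 1⟩ : ℍ[ℚ,((-1 : ℤ) : ℚ),((3 : ℤ) : ℚ)]))) ⟨Real.sqrt 3 / 3, Real.sqrt 6 / 3⟩, im_w3_tauSix_pos⟩ moebius_rho_w3_tauSix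
  exact isRhoIsomorphic_of_conj_norm_one (a := -1) (b := 3) (by norm_num) (by norm_num) (x := (⟨0, 21, 8, 9⟩ : ℍ[ℚ,((-1 : ℤ) : ℚ),((3 : ℤ) : ℚ)])) (y := ⟨0, 9, 4, -3⟩)
    (e := ⟨3, 2, 2, 0⟩) rfl (by rw [QuaternionAlgebra.star_mk, QuaternionAlgebra.mk_mul_mk]; norm_num) w2Units_mem_and_norm.2.2.1.1
    w2Units_mem_and_norm.2.2.1.2 w2_witness_conj.2.2.2.2.2.2.1 (im_w2_coe_pos ⟨moebius (rho (-1) 3 (by norm_num) (castQ (-1) 3 (⟨3, 0, 1, 1⟩ : ℍ[ℚ,((-1 : ℤ) : ℚ),((3 : ℤ) : ℚ)]))) ⟨Real.sqrt 3 / 3, Real.sqrt 6 / 3⟩, im_w3_tauSix_pos⟩) im_w3_axis_pos hfix moebius_rho_w3_axis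

/-- **`w₂(w₃(i√(2−√3))) ≅_ρ w₃(τ₆)`**: `ρ(Ad(1+i)x)` fixes `w₂(z_x)` for `x = (9, 4, -3)`, `Ad(1+i)x = (9, 3, 4)`, and the norm-one unit `(2, 3, 2, 0)` conjugates it to the special vector `(21, 9, -8)` of `w₃(τ₆)`. [cite: KudlaRapoportYang2006, §3.2 Prop. 3.2.1 and §3.4 (3.4.9), (3.4.13)] [cite: Ogg1983RealPoints, §2 p. 283] -/
theorem isRhoIsomorphic_w2_w3axis_w3tauSix :
    IsRhoIsomorphic (a := -1) (b := 3) (by norm_num) (by norm_num) (im_w2_coe_pos ⟨moebius (rho (-1) 3 (by norm_num) (castQ (-1) 3 (⟨3, 0, 1, 1⟩ : ℍ[ℚ,((-1 : ℤ) : ℚ),((3 : ℤ) : ℚ)]))) (((Real.sqrt (2 - Real.sqrt 3) : ℝ) : ℂ) * I), im_w3_axis_pos⟩).ne' im_w3_tauSix_pos.ne' := by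
  have hfix : moebius (rho (-1) 3 (by norm_num) (castQ (-1) 3 (⟨0, 9, 3, 4⟩ : ℍ[ℚ,((-1 : ℤ) : ℚ),((3 : ℤ) : ℚ)])))
      (moebius (rho (-1) 3 (by norm_num) (castQ (-1) 3 (⟨1, 1, 0, 0⟩ : ℍ[ℚ,((-1 : ℤ) : ℚ),((3 : ℤ) : ℚ)]))) ((⟨moebius (rho (-1) 3 (by norm_num) (castQ (-1) 3 (⟨3, 0, 1, 1⟩ : ℍ[ℚ,((-1 : ℤ) : ℚ),((3 : ℤ) : ℚ)]))) (((Real.sqrt (2 - Real.sqrt 3) : ℝ) : ℂ) * I), im_w3_axis_pos⟩ : UpperHalfPlane) : ℂ)) =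
      moebius (rho (-1) 3 (by norm_num) (castQ (-1) 3 (⟨1, 1, 0, 0⟩ : ℍ[ℚ,((-1 : ℤ) : ℚ),((3 : ℤ) : ℚ)]))) ((⟨moebius (rho (-1) 3 (by norm_num) (castQ (-1) 3 (⟨3, 0, 1, 1⟩ : ℍ[ℚ,((-1 : ℤ) : ℚ),((3 : ℤ) : ℚ)]))) (((Real.sqrt (2 - Real.sqrt 3) : ℝ) : ℂ) * I), im_w3_axis_pos⟩ : UpperHalfPlane) : ℂ) :=
    moebius_rho_ad_one_add_i_fixed (x := (⟨0, 9, 4, -3⟩ : ℍ[ℚ,((-1 : ℤ) : ℚ),((3 : ℤ) : ℚ)])) ⟨moebius (rho (-1) 3 (by norm_num) (castQ (-1) 3 (⟨3, 0, 1, 1⟩ : ℍ[ℚ,((-1 : ℤ) : ℚ),((3 : ℤ) : ℚ)]))) (((Real.sqrt (2 - Real.sqrt 3) : ℝ) : ℂ) * I), im_w3_axis_pos⟩ moebius_rho_w3_axis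
  exact isRhoIsomorphic_of_conj_norm_one (a := -1) (b := 3) (by norm_num) (by norm_num) (x := (⟨0, 9, 3, 4⟩ : ℍ[ℚ,((-1 : ℤ) : ℚ),((3 : ℤ) : ℚ)])) (y := ⟨0, 21, 9, -8⟩)
    (e := ⟨2, 3, 2, 0⟩) rfl (by rw [QuaternionAlgebra.star_mk, QuaternionAlgebra.mk_mul_mk]; norm_num) w2Units_mem_and_norm.2.1.1
    w2Units_mem_and_norm.2.1.2 w2_witness_conj.2.2.2.2.2.2.2.1 (im_w2_coe_pos ⟨moebius (rho (-1) 3 (by norm_num) (castQ (-1) 3 (⟨3, 0, 1, 1⟩ : ℍ[ℚ,((-1 : ℤ) : ℚ),((3 : ℤ) : ℚ)]))) (((Real.sqrt (2 - Real.sqrt 3) : ℝ) : ℂ) * I), im_w3_axis_pos⟩) im_w3_tauSix_pos hfix moebius_rho_w3_tauSix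

/-- **`w₂(w₃(τ₆″)) ≅_ρ τ₆″`**: `ρ(Ad(1+i)x)` fixes `w₂(z_x)` for `x = (18, 9, -5)`, `Ad(1+i)x = (18, 5, 9)`, and the norm-one unit `(0, -4, -1, -2)` conjugates it to the special vector `(6, 1, 3)` of `τ₆″`. [cite: KudlaRapoportYang2006, §3.2 Prop. 3.2.1 and §3.4 (3.4.9), (3.4.13)] [cite: Ogg1983RealPoints, §2 p. 283] -/
theorem isRhoIsomorphic_w2_w3tauSixBis_tauSixBis :
    IsRhoIsomorphic (a := -1) (b := 3) (by norm_num) (by norm_num) (im_w2_coe_pos ⟨moebius (rho (-1) 3 (by norm_num) (castQ (-1) 3 (⟨3, 0, 1, 1⟩ : ℍ[ℚ,((-1 : ℤ) : ℚ),((3 : ℤ) : ℚ)]))) ⟨Real.sqrt 3 / (6 + 3 * Real.sqrt 3), Real.sqrt 6 / (6 + 3 * Real.sqrt 3)⟩, im_w3_tauSixBis_pos⟩).ne' tauSixBis_im_pos.ne' := by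
  have hfix : moebius (rho (-1) 3 (by norm_num) (castQ (-1) 3 (⟨0, 18, 5, 9⟩ : ℍ[ℚ,((-1 : ℤ) : ℚ),((3 : ℤ) : ℚ)])))
      (moebius (rho (-1) 3 (by norm_num) (castQ (-1) 3 (⟨1, 1, 0, 0⟩ : ℍ[ℚ,((-1 : ℤ) : ℚ),((3 : ℤ) : ℚ)]))) ((⟨moebius (rho (-1) 3 (by norm_num) (castQ (-1) 3 (⟨3, 0, 1, 1⟩ : ℍ[ℚ,((-1 : ℤ) : ℚ),((3 : ℤ) : ℚ)]))) ⟨Real.sqrt 3 / (6 + 3 * Real.sqrt 3), Real.sqrt 6 / (6 + 3 * Real.sqrt 3)⟩, im_w3_tauSixBis_pos⟩ : UpperHalfPlane) : ℂ)) =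
      moebius (rho (-1) 3 (by norm_num) (castQ (-1) 3 (⟨1, 1, 0, 0⟩ : ℍ[ℚ,((-1 : ℤ) : ℚ),((3 : ℤ) : ℚ)]))) ((⟨moebius (rho (-1) 3 (by norm_num) (castQ (-1) 3 (⟨3, 0, 1, 1⟩ : ℍ[ℚ,((-1 : ℤ) : ℚ),((3 : ℤ) : ℚ)]))) ⟨Real.sqrt 3 / (6 + 3 * Real.sqrt 3), Real.sqrt 6 / (6 + 3 * Real.sqrt 3)⟩, im_w3_tauSixBis_pos⟩ : UpperHalfPlane) : ℂ) :=
    moebius_rho_ad_one_add_i_fixed (x := (⟨0, 18, 9, -5⟩ : ℍ[ℚ,((-1 : ℤ) : ℚ),((3 : ℤ) : ℚ)])) ⟨moebius (rho (-1) 3 (by norm_num) (castQ (-1) 3 (⟨3, 0, 1, 1⟩ : ℍ[ℚ,((-1 : ℤ) : ℚ),((3 : ℤ) : ℚ)]))) ⟨Real.sqrt 3 / (6 + 3 * Real.sqrt 3), Real.sqrt 6 / (6 + 3 * Real.sqrt 3)⟩, im_w3_tauSixBis_pos⟩ moebius_rho_w3_tauSixBis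
  exact isRhoIsomorphic_of_conj_norm_one (a := -1) (b := 3) (by norm_num) (by norm_num) (x := (⟨0, 18, 5, 9⟩ : ℍ[ℚ,((-1 : ℤ) : ℚ),((3 : ℤ) : ℚ)])) (y := ⟨0, 6, 1, 3⟩)
    (e := ⟨0, -4, -1, -2⟩) rfl (by rw [QuaternionAlgebra.star_mk, QuaternionAlgebra.mk_mul_mk]; norm_num) w2Units_mem_and_norm.2.2.2.2.1
    w2Units_mem_and_norm.2.2.2.2.2 w2_witness_conj.2.2.2.2.2.2.2.2 (im_w2_coe_pos ⟨moebius (rho (-1) 3 (by norm_num) (castQ (-1) 3 (⟨3, 0, 1, 1⟩ : ℍ[ℚ,((-1 : ℤ) : ℚ),((3 : ℤ) : ℚ)]))) ⟨Real.sqrt 3 / (6 + 3 * Real.sqrt 3), Real.sqrt 6 / (6 + 3 * Real.sqrt 3)⟩, im_w3_tauSixBis_pos⟩) tauSixBis_im_pos hfix moebius_rho_tauSixBis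

end WTwoZSix

/-! ## §5 Fixed classes: `w₂` fixes `[i]`, `[w₃i]` on `Z(1)` and nothing on `Z(6)`; `w₆σ²` fixes `[τ₆]` -/

section Stabilisers

/-- **On `Z(1)`, `w₂` fixes exactly the classes of `i` (`w₂i = i`) and `w₃i`, and swaps `τ_h ↔ τ_k`, `w₃τ_h ↔ w₃τ_k`** — the
coset action of `D₆ = ⟨σ, w₂, w₃⟩` on `D₆/⟨w₂⟩`: `w₂i = i` (the tree's `moebius_rho_one_add_i_I`), `w₂(w₃i) ≅_ρ w₃i`,
`w₂τ_h = τ_k ≇_ρ τ_h`, `w₂(w₃τ_h) ≅_ρ w₃τ_k ≇_ρ w₃τ_h`. [cite: KudlaRapoportYang2006, §3.4 Remark 3.4.7 and (3.4.13)] [cite: Ogg1983RealPoints, §2 p. 283] -/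
theorem w2_zOne_fixed_classes :
    moebius (rho (-1) 3 (by norm_num) (castQ (-1) 3 (⟨1, 1, 0, 0⟩ : ℍ[ℚ,((-1 : ℤ) : ℚ),((3 : ℤ) : ℚ)]))) I = I ∧
    IsRhoIsomorphic (a := -1) (b := 3) (by norm_num) (by norm_num) (im_w2_coe_pos ⟨_, im_w3_I_pos⟩).ne' im_w3_I_pos.ne' ∧
    ¬ IsRhoIsomorphic (a := -1) (b := 3) (by norm_num) (by norm_num) (im_w2_coe_pos ⟨_, tauHex_im_pos⟩).ne'
      tauHex_im_pos.ne' ∧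
    ¬ IsRhoIsomorphic (a := -1) (b := 3) (by norm_num) (by norm_num) (im_w2_coe_pos ⟨_, im_w3_tauHex_pos⟩).ne'
      im_w3_tauHex_pos.ne' := by
  refine ⟨moebius_rho_one_add_i_I, isRhoIsomorphic_w2_w3I_w3I, fun h ↦ ?_, fun h ↦ ?_⟩
  · -- `w₂τ_h = τ_k`
    have h' := (isRhoIsomorphic_of_eq' (im_w2_coe_pos ⟨_, tauHex_im_pos⟩).ne' tauK_im_ne_zero
      moebius_rho_one_add_i_tauHex).symm.trans h
    exact zOne_six_points.2.2.2.2.2.1 h'.symm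
  · exact zOne_six_points.2.2.2.2.2.2.2.2.2.2.2.2.2.2 (isRhoIsomorphic_w2_w3tauHex_w3tauK.symm.trans h).symm

/-- **On `Z(6)`, `w₂` fixes NO class: `w₂τ₆ = i√(2−√3) ≇_ρ τ₆`, `w₂τ₆″ ≅_ρ w₃τ₆″ ≇_ρ τ₆″`, `w₂(w₃τ₆) ≅_ρ w₃ i√(2−√3) ≇_ρ w₃τ₆`**
(and symmetrically for the other three) — on `Z(6)` the six classes are the coset space of `D₆` by a reflection other than
`w₂`. [cite: KudlaRapoportYang2006, §3.4 Remark 3.4.7 and (3.4.13)] [cite: Ogg1983RealPoints, §2 p. 283] -/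
theorem w2_zSix_no_fixed_class :
    ¬ IsRhoIsomorphic (a := -1) (b := 3) (by norm_num) (by norm_num)
        (im_w2_coe_pos ⟨⟨Real.sqrt 3 / 3, Real.sqrt 6 / 3⟩, tauSix_im_pos⟩).ne' tauSix_im_pos.ne' ∧
    ¬ IsRhoIsomorphic (a := -1) (b := 3) (by norm_num) (by norm_num)
        (im_w2_coe_pos ⟨_, tauSixBis_im_pos⟩).ne' tauSixBis_im_pos.ne' ∧
    ¬ IsRhoIsomorphic (a := -1) (b := 3) (by norm_num) (by norm_num)
        (im_w2_coe_pos ⟨_, im_w3_tauSix_pos⟩).ne' im_w3_tauSix_pos.ne' := by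
  refine ⟨fun h ↦ ?_, fun h ↦ ?_, fun h ↦ ?_⟩
  · have h' := (isRhoIsomorphic_of_eq' (im_w2_coe_pos ⟨_, tauSix_im_pos⟩).ne'
      (ofReal_mul_I_im_ne_zero sqrt_two_sub_sqrt_three_pos.ne') moebius_rho_one_add_i_tauSix).symm.trans h
    exact zSix_six_points.1 h'.symm
  · exact zSix_six_points.2.2.2.2.2.2.2.2.2.2.2.1 (isRhoIsomorphic_w2_tauSixBis_w3tauSixBis.symm.trans h).symm
  · exact zSix_six_points.2.2.2.2.2.2.2.2.2.2.2.2.1 (isRhoIsomorphic_w2_w3tauSix_w3axis.symm.trans h).symm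

/-- **`w₆σ² = w₂w₃σσ` FIXES the class of `τ₆`**: `σ²τ₆ ≅_ρ w₃ i√(2−√3)` (g30-#3), `w₃(w₃ i√(2−√3)) = ρ(5 + 2j + 2ij) i√(2−√3)
≅_ρ i√(2−√3)`, `w₂ i√(2−√3) ≅_ρ τ₆` — the stabiliser of `[τ₆]` in `D₆` is the reflection `⟨w₆σ²⟩`, so `Z(6) ≅ D₆/⟨w₆σ²⟩`
as a `D₆`-set (six classes), just as `Z(1) ≅ D₆/⟨w₂⟩`. [cite: KudlaRapoportYang2006, §3.4 Remark 3.4.7 and (3.4.13)] [cite: Ogg1983RealPoints, §2 p. 283] -/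
theorem isRhoIsomorphic_w2_w3_sigma_sigma_tauSix :
    IsRhoIsomorphic (a := -1) (b := 3) (by norm_num) (by norm_num)
      (im_w2_coe_pos ⟨_, im_w3_coe_pos ⟨_, im_sigma_coe_pos ⟨_, im_sigma_coe_pos
        ⟨⟨Real.sqrt 3 / 3, Real.sqrt 6 / 3⟩, tauSix_im_pos⟩⟩⟩⟩).ne' tauSix_im_pos.ne' := by
  -- `σ²τ₆ ≅ w₃axis`
  have h1 := zSix_one_orbit.2.1
  -- `w₃σ²τ₆ ≅ w₃w₃axis ≅ axis`
  have h2 := IsRhoIsomorphic.w3 (im_sigma_coe_pos ⟨_, im_sigma_coe_pos ⟨⟨Real.sqrt 3 / 3, Real.sqrt 6 / 3⟩, tauSix_im_pos⟩⟩)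
    im_w3_axis_pos h1
  have h3 : IsRhoIsomorphic (a := -1) (b := 3) (by norm_num) (by norm_num)
      (im_w3_coe_pos ⟨_, im_w3_axis_pos⟩).ne' (ofReal_mul_I_im_ne_zero sqrt_two_sub_sqrt_three_pos.ne') := by
    refine (isRhoIsomorphic_iff_exists_unit_pm (a := -1) (b := 3) (by norm_num) (by norm_num) _ _).2
      ⟨star ⟨5, 0, 2, 2⟩, ?_, Or.inl ?_, ?_⟩
    · exact ⟨![5, 0, -2, -2], by rw [QuaternionAlgebra.star_mk]; ext <;> simp [ofCoords]⟩
    · rw [star_star, QuaternionAlgebra.star_mk, QuaternionAlgebra.mk_mul_mk]; ext <;> norm_num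
    · -- `ρ((5+2j+2ij)‾) (w₃ w₃ axis) = ρ((5+2j+2ij)‾)(ρ(5+2j+2ij) axis) = axis`
      have hsq := moebius_rho_three_add_j_add_ij_sq ⟨_, im_axis_pos⟩
      simp only at hsq
      change moebius _ (moebius _ (moebius _ _)) = _
      rw [hsq]
      exact moebius_rho_star_moebius_rho (a := -1) (b := 3) (by norm_num)
        (by rw [norm_five_add_two_j_add_two_ij]; norm_num) ⟨_, im_axis_pos⟩
  -- `w₂ axis ≅ τ₆`
  have h4 := IsRhoIsomorphic.w2
    (im_w3_coe_pos ⟨_, im_sigma_coe_pos ⟨_, im_sigma_coe_pos ⟨⟨Real.sqrt 3 / 3, Real.sqrt 6 / 3⟩, tauSix_im_pos⟩⟩⟩)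
    im_axis_pos (h2.trans h3)
  exact h4.trans isRhoIsomorphic_w2_axis_tauSix

end Stabilisers

/-! ## §6 `Z(3)`: `w₂τ₃ = P₂` exactly, `w₃τ₃ ≅_ρ τ₃` — the orbit of `τ₃` under `D₆` is `{[P₄], [P₂]}` -/

section ZThree

/-- **`w₂(P₄) = P₂`: the Atkin–Lehner involution `w₂` SWAPS the two order-three elliptic points of `X₆`** —
`Ad(1 + i)(3i + j + ij) = 3i − j + ij = x′` fixes `w₂τ₃`, and `P₂` is the unique fixed point of `ρ(x′)` in `𝔥` (g30-#5).
[cite: BayerTravesa2007, §1 Thm. 1.1, Table 1 and §2 («`X₆^{(2)} := X₆/⟨ω₂⟩`»)] [cite: KudlaRapoportYang2006, §3.4 (3.4.9)] -/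
theorem moebius_rho_one_add_i_tauThree :
    moebius (rho (-1) 3 (by norm_num) (castQ (-1) 3 (⟨1, 1, 0, 0⟩ : ℍ[ℚ,((-1 : ℤ) : ℚ),((3 : ℤ) : ℚ)])))
      ⟨(Real.sqrt 3 - 1) / 2, (Real.sqrt 3 - 1) / 2⟩ = ⟨(1 - Real.sqrt 3) / 2, (Real.sqrt 3 - 1) / 2⟩ := by
  have hfix : moebius (rho (-1) 3 (by norm_num) (castQ (-1) 3 (⟨0, 3, -1, 1⟩ : ℍ[ℚ,((-1 : ℤ) : ℚ),((3 : ℤ) : ℚ)])))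
      (moebius (rho (-1) 3 (by norm_num) (castQ (-1) 3 (⟨1, 1, 0, 0⟩ : ℍ[ℚ,((-1 : ℤ) : ℚ),((3 : ℤ) : ℚ)])))
        ((⟨_, tauThree_im_pos⟩ : UpperHalfPlane) : ℂ)) =
      moebius (rho (-1) 3 (by norm_num) (castQ (-1) 3 (⟨1, 1, 0, 0⟩ : ℍ[ℚ,((-1 : ℤ) : ℚ),((3 : ℤ) : ℚ)])))
        ((⟨_, tauThree_im_pos⟩ : UpperHalfPlane) : ℂ) :=
    moebius_rho_ad_one_add_i_fixed (x := ⟨0, 3, 1, 1⟩) ⟨_, tauThree_im_pos⟩ moebius_rho_tauThree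
  have key := (existsUnique_fixedPoint_of_special (a := -1) (b := 3) (by norm_num)
    (x := (⟨0, 3, -1, 1⟩ : ℍ[ℚ,((-1 : ℤ) : ℚ),((3 : ℤ) : ℚ)])) rfl (by rw [norm_three_i_sub_j_add_ij]; norm_num)).unique
    (y₁ := ⟨_, im_w2_coe_pos ⟨_, tauThree_im_pos⟩⟩) (y₂ := ⟨_, tauThreeBis_im_pos⟩) hfix moebius_rho_tauThreeBis
  rwa [UpperHalfPlane.ext_iff] at key

/-- **`w₃τ₃ ≅_ρ τ₃`**: `Ad(μ)(3i + j + ij) = 15i + 7j − 5ij` and the unit `2 − 3i − 2j ∈ 𝔬¹` conjugates it back to `3i + j + ij`;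
with `στ₃ ≅_ρ τ₃` (g30-#5) the stabiliser of `[τ₃]` in `D₆` contains `⟨σ, w₃⟩` (index `2`), and `w₂` moves it to `[P₂] ≠ [τ₃]`:
**the `D₆`-orbit of `τ₃` consists of the two classes `[P₄]`, `[P₂]`**. [cite: BayerTravesa2007, §1 Thm. 1.1] [cite: KudlaRapoportYang2006, §3.2 Prop. 3.2.1 and §3.4 (3.4.13)] -/
theorem isRhoIsomorphic_w3_tauThree_tauThree :
    IsRhoIsomorphic (a := -1) (b := 3) (by norm_num) (by norm_num) (im_w3_coe_pos ⟨_, tauThree_im_pos⟩).ne'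
      tauThree_im_pos.ne' :=
  isRhoIsomorphic_of_conj_norm_one (a := -1) (b := 3) (by norm_num) (by norm_num)
    (x := (⟨0, 15, 7, -5⟩ : ℍ[ℚ,((-1 : ℤ) : ℚ),((3 : ℤ) : ℚ)])) (y := ⟨0, 3, 1, 1⟩) (e := ⟨2, -3, -2, 0⟩) rfl
    (by rw [norm_three_i_add_j_add_ij]; norm_num) ⟨![2, -3, -2, 0], by ext <;> simp [ofCoords]⟩
    (by rw [QuaternionAlgebra.star_mk, QuaternionAlgebra.mk_mul_mk]; ext <;> norm_num)
    (by rw [QuaternionAlgebra.star_mk, QuaternionAlgebra.mk_mul_mk, QuaternionAlgebra.mk_mul_mk]; ext <;> norm_num)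
    (im_w3_coe_pos ⟨_, tauThree_im_pos⟩) tauThree_im_pos
    (moebius_rho_fixed_of_three_add_j_add_ij_conj (x := ⟨0, 3, 1, 1⟩)
      (by rw [QuaternionAlgebra.star_mk, QuaternionAlgebra.mk_mul_mk, QuaternionAlgebra.mk_mul_mk, QuaternionAlgebra.smul_mk]
          ext <;> norm_num)
      ⟨_, tauThree_im_pos⟩ moebius_rho_tauThree)
    moebius_rho_tauThree

/-- **ORBIT SUMMARY for `Z(3)`**: `στ₃ ≅_ρ τ₃`, `w₃τ₃ ≅_ρ τ₃`, `w₂τ₃ = P₂ ≇_ρ τ₃` — two classes `{[P₄], [P₂]}`, merged on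
`X₆/⟨w₂⟩`. [cite: BayerTravesa2007, §1 Thm. 1.1 and §2] [cite: KudlaRapoportYang2006, §3.4 (3.4.13)] -/
theorem zThree_orbit_summary :
    IsRhoIsomorphic (a := -1) (b := 3) (by norm_num) (by norm_num) (im_sigma_coe_pos ⟨_, tauThree_im_pos⟩).ne'
        tauThree_im_pos.ne' ∧
    IsRhoIsomorphic (a := -1) (b := 3) (by norm_num) (by norm_num) (im_w3_coe_pos ⟨_, tauThree_im_pos⟩).ne'
        tauThree_im_pos.ne' ∧
    moebius (rho (-1) 3 (by norm_num) (castQ (-1) 3 (⟨1, 1, 0, 0⟩ : ℍ[ℚ,((-1 : ℤ) : ℚ),((3 : ℤ) : ℚ)])))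
      ⟨(Real.sqrt 3 - 1) / 2, (Real.sqrt 3 - 1) / 2⟩ = ⟨(1 - Real.sqrt 3) / 2, (Real.sqrt 3 - 1) / 2⟩ ∧
    ¬ IsRhoIsomorphic (a := -1) (b := 3) (by norm_num) (by norm_num) tauThree_im_pos.ne' tauThreeBis_im_pos.ne' :=
  ⟨isRhoIsomorphic_sigma_tauThree_tauThree, isRhoIsomorphic_w3_tauThree_tauThree, moebius_rho_one_add_i_tauThree,
    not_isRhoIsomorphic_tauThree_tauThreeBis⟩

end ZThree

end Literature.Geometry.Kaehler.ComplexTorus.QuaternionType
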